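import Summits.BirchSwinnertonDyer.BirchSwinnertonDyer.Theorems.InertBadSignedBranchesInertBadAtThreeQuarticCleanAssemblyEven
import Summits.BirchSwinnertonDyer.BirchSwinnertonDyer.Theorems.InertBadSignedBranchesInertBadAtThreeQuarticValueExit
import Summits.BirchSwinnertonDyer.BirchSwinnertonDyer.Theorems.InertBadSignedBranchesInertBadAtThreeQuarticModelKRange
import HarnessLib

/-!
# The v4 quartic stub (both parities: F-es-18's body on the quartic cell) from the theta dictionary ALONE

Summit `BirchSwinnertonDyer`, crux `InertBadAtThree` (stmt-BirchSwinnertonDyer-19225; K8 `InertBadSignedBranches` r4 / BED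
`BiquadraticEisensteinDescent` r5), line of record `Cruxes/InertBadAtThree/Lines/rubin_e1_inert_three.lean` (lead `bsd-line-ibd-p1`).
The registered v5 stub `stub_plainOddNeronIntegralThreeQuartic` needs only odd characters of prime modulus; the older v4 statement
`NeronIntegralThreeQuartic` (= the body of the named Literature statement F-es-18 `kato_neron_isIntegral_twistedSymbolSum_of_additive_three_polar`
on the whole quartic cell `j = 1728`, BOTH parities, every primitive `χ` of modulus prime to `3N`; consumers: crux 22968's `kato_shift_three`
on the cell, K8 child 19657) is strictly stronger. This file (width seat bsd-wall-cm-bed-w1 g7, assigned by the lead 11:59Z) is the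
TWO-PARITY V-LEVEL GLUE: `NeronIntegralThreeQuartic` VERBATIM (restated inline — Lines files are not importable) from ONE hypothesis, the
theta dictionary for the quartic MODELS (STUB-PLAN P1b; providers bed-w4 g9 / bed-w2 g9), in the shape `hdictAll` below (all moduli `m` with
`3 ∤ m`, all primitive `χ`; `q` the `(·/3)₄` table as a section hypothesis `hq`, exactly as in the lead's assembly files).

Chain (all by name): bed-w3 g8's model with `k`-range `…QuarticModelKRange.exists_smul_eq_quartic_padicValInt_mem`
(`C • V = ⟨0,0,0,A,0⟩`, `v₃(u_C) = 0`, `3 ∣ A`, `3⁴ ∤ A`, `1 ≤ v₃(A) ≤ 3`) → the lead's model-level ★ theorems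
`…QuarticCleanAssembly.oddLValue_quartic_of_dictionary` / `evenLValue_quartic_of_dictionary` (which consume this seat's P6a/b/c) →
bed-w3 g8's transport `…QuarticModel.LValueOdd_of_smul` / `LValueEven_of_smul` → bed-w3 g8's value exit
`…QuarticValueExit.neronIntegralThreeQuartic_of_LValues`.

* `hEven_of_dictionary`, `hOdd_of_dictionary` — the two V-level `f`-free hypotheses of `neronIntegralThreeQuartic_of_LValues`;
* ★ **`neronIntegralThreeQuartic_of_dictionary`** — `hq → hdictAll → NeronIntegralThreeQuartic` (v4 text verbatim).

HONEST FRAMING: conditional on `hdictAll` (the dictionary P1b, not yet in the tree); nothing here proves the registered stub, the crux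
`InertBadAtThree`, F-es-18, or BSD. No definitions, no named facts, no `sorry`; axioms standard.
-/

set_option linter.dupNamespace false
set_option autoImplicit false

noncomputable section

open scoped ComplexConjugate
open Complex WeierstrassCurve
open Literature.NumberTheory.EllipticCurves Literature.NumberTheory.EllipticCurves.ModularForms
open Literature.NumberTheory.LFunctions Literature.NumberTheory.LFunctions.GaussianTheta

namespace Summit.BirchSwinnertonDyer.BirchSwinnertonDyer.Theorems.InertBadSignedBranchesInertBadAtThreeQuarticTwoParityOfDictionary

open Summit.BirchSwinnertonDyer.BirchSwinnertonDyer.Theorems.InertBadSignedBranchesInertBadAtThreeQuarticCleanAssembly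
  (oddLValue_quartic_of_dictionary evenLValue_quartic_of_dictionary)
open Summit.BirchSwinnertonDyer.BirchSwinnertonDyer.Theorems.InertBadSignedBranchesInertBadAtThreeQuarticModel
  (LValueOdd_of_smul LValueEven_of_smul Δ_quartic)
open Summit.BirchSwinnertonDyer.BirchSwinnertonDyer.Theorems.InertBadSignedBranchesInertBadAtThreeQuarticModelKRange
  (exists_smul_eq_quartic_padicValInt_mem)
open Summit.BirchSwinnertonDyer.BirchSwinnertonDyer.Theorems.InertBadSignedBranchesInertBadAtThreeQuarticValueExit
  (neronIntegralThreeQuartic_of_LValues)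

variable {q : GaussianInt → ℂ}
  (hq : ∀ x : GaussianInt, q x =
    if (3 : ℤ) ∣ x.re ∧ (3 : ℤ) ∣ x.im then 0
    else if (3 : ℤ) ∣ x.im then 1
    else if (3 : ℤ) ∣ x.re then -1
    else if (3 : ℤ) ∣ x.re - x.im then -I
    else I)

/-- A quartic model of an elliptic curve has `A ≠ 0` (`Δ(y² = x³ + Ax) = −64A³`). -/
theorem ne_zero_of_smul_eq_quartic {V : WeierstrassCurve ℚ} [V.IsElliptic] {A : ℤ} {C : VariableChange ℚ}
    (hCV : C • V = ⟨0, 0, 0, (A : ℚ), 0⟩) : A ≠ 0 := by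
  intro hA
  have hΔ : (C • V).Δ ≠ 0 := (C • V).isUnit_Δ.ne_zero
  rw [hCV, Δ_quartic, hA] at hΔ
  norm_num at hΔ

/-- `3^{v₃(A)} ∣ |A|`. -/
theorem pow_padicValInt_dvd_natAbs (A : ℤ) : 3 ^ padicValInt 3 A ∣ A.natAbs :=
  pow_padicValNat_dvd

include hq

/-- **EVEN V-level hypothesis of `neronIntegralThreeQuartic_of_LValues` from the dictionary.** For every globally minimal `V` with
`j = 1728` bad at `3`, every `m` with `3 ∤ m` and primitive `χ` mod `m`: SOME entire `L` continuing `Σ χ̄(n)a_n(V)n⁻ˢ` has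
`s·τ(χ)·L(1)/Ω⁺(V) ∈ ℤ̄`, `3 ∤ s` — via the model `C • V = ⟨0,0,0,A,0⟩` (`v₃(u_C) = 0`, `1 ≤ v₃(A) ≤ 3`), the lead's
`evenLValue_quartic_of_dictionary` and `LValueEven_of_smul`. (The stub's extra binders `χ ≠ 1`, `3 ∤ ord χ`, `χ(3) ≠ ±1`, `χ.Even` are
not used.) -/
theorem hEven_of_dictionary
    (hdictAll : ∀ (A : ℤ), A ≠ 0 → (3 : ℤ) ∣ A → ¬ (3 : ℤ) ^ 4 ∣ A →
      ∀ (m : ℕ) [NeZero m], ¬ 3 ∣ m → ∀ χ : DirichletCharacter ℂ m, χ.IsPrimitive →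
      ∃ (M' : ℕ) (_ : NeZero M') (_ : NeZero (3 * M')) (Ψ : GaussianInt → ℂ),
        Nat.Coprime 3 M' ∧ (∀ x y : GaussianInt, Ψ (x + M' * y) = Ψ x) ∧ (∀ x : GaussianInt, IsIntegral ℤ (Ψ x)) ∧
        ∀ s : ℂ, 2 < s.re →
          LSeries (fun n : ℕ ↦ χ⁻¹ (n : ZMod m) * ((⟨0, 0, 0, (A : ℚ), 0⟩ : WeierstrassCurve ℚ).LFunction n : ℂ)) s =
            (1 / 4 : ℂ) * thetaLFunction (3 * M') (fun x ↦ (conj (q x)) ^ (padicValInt 3 A) * Ψ x) s) :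
    ∀ (V : WeierstrassCurve ℚ) [V.IsElliptic] [V.IsGloballyMinimal], V.j = 1728 → ¬ V.HasGoodReductionAtPrime 3 →
      ∀ (m : ℕ) [NeZero m], ¬ 3 ∣ m → ∀ χ : DirichletCharacter ℂ m, χ.IsPrimitive → χ ≠ 1 → ¬ 3 ∣ orderOf χ →
      χ (3 : ZMod m) ≠ 1 → χ (3 : ZMod m) ≠ -1 → χ.Even →
      ∃ L : ℂ → ℂ, Differentiable ℂ L ∧
        (∀ s : ℂ, 2 < s.re → L s = LSeries (fun n : ℕ ↦ χ⁻¹ (n : ZMod m) * (V.LFunction n : ℂ)) s) ∧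
        ∃ s : ℕ, ¬ 3 ∣ s ∧ IsIntegral ℤ ((s : ℂ) *
          (gaussSum χ (ZMod.stdAddChar (N := m)) * L 1 / (V.realPeriodRat : ℂ))) := by
  intro V _ _ hj hbad m _ h3m χ hχ _ _ _ _ _
  haveI : Fact (Nat.Prime 3) := ⟨Nat.prime_three⟩
  obtain ⟨A, C, hCV, hu, h3A, h81, hk1, hk3⟩ := exists_smul_eq_quartic_padicValInt_mem V hj hbad
  have hA0 : A ≠ 0 := ne_zero_of_smul_eq_quartic hCV
  refine LValueEven_of_smul (p := 3) V C (KramerTwoDescent.not_dvd_den_of_padicValRat_eq_zero hu) χ ?_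
  rw [hCV]
  obtain ⟨M', hM', hM3, Ψ, hcop, hper, hint, hdict⟩ := hdictAll A hA0 h3A h81 m h3m χ hχ
  exact evenLValue_quartic_of_dictionary hq A hA0 hk1 hk3 (pow_padicValInt_dvd_natAbs A) χ hcop Ψ hper hint hdict

/-- **ODD V-level hypothesis of `neronIntegralThreeQuartic_of_LValues` from the dictionary** (`i·Ω⁻(V)`), via the lead's
`oddLValue_quartic_of_dictionary` and `LValueOdd_of_smul`. -/
theorem hOdd_of_dictionary
    (hdictAll : ∀ (A : ℤ), A ≠ 0 → (3 : ℤ) ∣ A → ¬ (3 : ℤ) ^ 4 ∣ A →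
      ∀ (m : ℕ) [NeZero m], ¬ 3 ∣ m → ∀ χ : DirichletCharacter ℂ m, χ.IsPrimitive →
      ∃ (M' : ℕ) (_ : NeZero M') (_ : NeZero (3 * M')) (Ψ : GaussianInt → ℂ),
        Nat.Coprime 3 M' ∧ (∀ x y : GaussianInt, Ψ (x + M' * y) = Ψ x) ∧ (∀ x : GaussianInt, IsIntegral ℤ (Ψ x)) ∧
        ∀ s : ℂ, 2 < s.re →
          LSeries (fun n : ℕ ↦ χ⁻¹ (n : ZMod m) * ((⟨0, 0, 0, (A : ℚ), 0⟩ : WeierstrassCurve ℚ).LFunction n : ℂ)) s =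
            (1 / 4 : ℂ) * thetaLFunction (3 * M') (fun x ↦ (conj (q x)) ^ (padicValInt 3 A) * Ψ x) s) :
    ∀ (V : WeierstrassCurve ℚ) [V.IsElliptic] [V.IsGloballyMinimal], V.j = 1728 → ¬ V.HasGoodReductionAtPrime 3 →
      ∀ (m : ℕ) [NeZero m], ¬ 3 ∣ m → ∀ χ : DirichletCharacter ℂ m, χ.IsPrimitive → χ ≠ 1 → ¬ 3 ∣ orderOf χ →
      χ (3 : ZMod m) ≠ 1 → χ (3 : ZMod m) ≠ -1 → χ.Odd →
      ∃ L : ℂ → ℂ, Differentiable ℂ L ∧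
        (∀ s : ℂ, 2 < s.re → L s = LSeries (fun n : ℕ ↦ χ⁻¹ (n : ZMod m) * (V.LFunction n : ℂ)) s) ∧
        ∃ s : ℕ, ¬ 3 ∣ s ∧ IsIntegral ℤ ((s : ℂ) *
          (gaussSum χ (ZMod.stdAddChar (N := m)) * L 1 / (Complex.I * (V.imaginaryPeriodRat : ℂ)))) := by
  intro V _ _ hj hbad m _ h3m χ hχ _ _ _ _ _
  haveI : Fact (Nat.Prime 3) := ⟨Nat.prime_three⟩
  obtain ⟨A, C, hCV, hu, h3A, h81, hk1, hk3⟩ := exists_smul_eq_quartic_padicValInt_mem V hj hbad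
  have hA0 : A ≠ 0 := ne_zero_of_smul_eq_quartic hCV
  refine LValueOdd_of_smul (p := 3) V C (KramerTwoDescent.not_dvd_den_of_padicValRat_eq_zero hu) χ ?_
  rw [hCV]
  obtain ⟨M', hM', hM3, Ψ, hcop, hper, hint, hdict⟩ := hdictAll A hA0 h3A h81 m h3m χ hχ
  exact oddLValue_quartic_of_dictionary hq A hA0 hk1 hk3 (pow_padicValInt_dvd_natAbs A) χ hcop Ψ hper hint hdict

/-- ★ **The v4 quartic stub `NeronIntegralThreeQuartic` (VERBATIM the text of `Lines/rubin_e1_inert_three.lean`'s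
`stub_neronIntegralThreeQuartic`: every globally minimal `V` with `j = 1728` bad at `3`, every level and newform, BOTH parities) from the
theta dictionary for the quartic models alone.** Composition of `hEven_of_dictionary` / `hOdd_of_dictionary` with bed-w3 g8's
`neronIntegralThreeQuartic_of_LValues`. [cite: Kato2004Asterisque, (8.1.3) (p. 180)] [cite: Rubin1999, Prop. 7.15] -/
theorem neronIntegralThreeQuartic_of_dictionary
    (hdictAll : ∀ (A : ℤ), A ≠ 0 → (3 : ℤ) ∣ A → ¬ (3 : ℤ) ^ 4 ∣ A →
      ∀ (m : ℕ) [NeZero m], ¬ 3 ∣ m → ∀ χ : DirichletCharacter ℂ m, χ.IsPrimitive →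
      ∃ (M' : ℕ) (_ : NeZero M') (_ : NeZero (3 * M')) (Ψ : GaussianInt → ℂ),
        Nat.Coprime 3 M' ∧ (∀ x y : GaussianInt, Ψ (x + M' * y) = Ψ x) ∧ (∀ x : GaussianInt, IsIntegral ℤ (Ψ x)) ∧
        ∀ s : ℂ, 2 < s.re →
          LSeries (fun n : ℕ ↦ χ⁻¹ (n : ZMod m) * ((⟨0, 0, 0, (A : ℚ), 0⟩ : WeierstrassCurve ℚ).LFunction n : ℂ)) s =
            (1 / 4 : ℂ) * thetaLFunction (3 * M') (fun x ↦ (conj (q x)) ^ (padicValInt 3 A) * Ψ x) s) :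
    ∀ (V : WeierstrassCurve ℚ) [V.IsElliptic] [V.IsGloballyMinimal],
      V.j = 1728 → ¬ V.HasGoodReductionAtPrime 3 →
      ∀ {N : ℕ} [NeZero N]
        (f : CuspForm (CongruenceSubgroup.Gamma0 N) 2)
        (_ : Literature.NumberTheory.EllipticCurves.ModularForms.IsNewformOf V f)
        (_ : ¬ V.HasGoodReductionAtPrime 3) (_ : ¬ V.HasMultiplicativeReductionAtPrime 3)
        (_ : V.HasIrreducibleModPGaloisRep 3) (m : ℕ) [NeZero m] (_ : m.Coprime (3 * N))
        (χ : DirichletCharacter ℂ m) (_ : χ.IsPrimitive) (_ : χ ≠ 1) (_ : ¬ 3 ∣ orderOf χ)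
        (_ : χ (3 : ZMod m) ≠ 1) (_ : χ (3 : ZMod m) ≠ -1) (ϖ : ℚ) (r : ℂ),
        (χ.Even → (ϖ : ℝ) * V.realPeriodRat = Literature.NumberTheory.EllipticCurves.ModularForms.plusPeriod f →
          (∏ ℓ ∈ N.primeFactors with ¬ ℓ ^ 2 ∣ N,
              (((ℓ : ℂ) - (V.LFunction ℓ : ℂ) * χ (ℓ : ZMod m)) *
                ((ℓ : ℂ) - (V.LFunction ℓ : ℂ) * (χ (ℓ : ZMod m))⁻¹))) *
              Literature.NumberTheory.EllipticCurves.ModularForms.twistedSymbolSum f χ =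
            r * (Literature.NumberTheory.EllipticCurves.ModularForms.plusPeriod f : ℂ) →
          ∃ s : ℕ, ¬ 3 ∣ s ∧ IsIntegral ℤ ((s : ℂ) * ϖ * r)) ∧
        (χ.Odd → (ϖ : ℝ) * V.imaginaryPeriodRat = Literature.NumberTheory.EllipticCurves.ModularForms.minusPeriod f →
          (∏ ℓ ∈ N.primeFactors with ¬ ℓ ^ 2 ∣ N,
              (((ℓ : ℂ) - (V.LFunction ℓ : ℂ) * χ (ℓ : ZMod m)) *
                ((ℓ : ℂ) - (V.LFunction ℓ : ℂ) * (χ (ℓ : ZMod m))⁻¹))) *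
              Literature.NumberTheory.EllipticCurves.ModularForms.twistedSymbolSum f χ =
            r * (Literature.NumberTheory.EllipticCurves.ModularForms.minusPeriod f : ℂ) * Complex.I →
          ∃ s : ℕ, ¬ 3 ∣ s ∧ IsIntegral ℤ ((s : ℂ) * ϖ * r)) :=
  neronIntegralThreeQuartic_of_LValues (hEven_of_dictionary hq hdictAll) (hOdd_of_dictionary hq hdictAll)

end Summit.BirchSwinnertonDyer.BirchSwinnertonDyer.Theorems.InertBadSignedBranchesInertBadAtThreeQuarticTwoParityOfDictionary

end
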